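import Summits.HodgeConjecture.CorCM.Census.CyclicCharacterEvenQuarticLaw

/-!
# Cyclic characters, XXVII: EVEN KERNEL — spectator ties and the two VERTICAL faces (the unit arc shifts at the interior positions)

COR-CM (cell `pub-hodgecm2`), count-neutral kernel combinatorics by the binder seat b09 (gen 43; lane CYCLIC-CHARACTER FIBRE LAW, part XXVII), on parts XX, XXI,
XXII, XXIV–XXVI BY NAME.  Theorems only (no definition, no `decide`, no certificate, no named fact, no `sorry`).
HONEST FRAMING: `HC_CM` is NOT proved, here or anywhere in the tree; nothing here is a period or a headline.

For `k ≥ 3` the certificate needs, besides `ζ` and `R(C)` (parts XXV/XXVI), the UNIT ARC SHIFT `ε_u − η_u` at one spectator `u` per interior position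
`1 ≤ w u ≤ 2ᵏ⁻¹ − 2` (part XXII).  With an EVEN kernel gen 42ʼs spectator three-across face has two SPECTATOR-TIE corners (`X_C ∪ u`, `X_{C∖b∪t} ∪ u`, at distance
`m + 1` from `T_0` and from `T_1`) and yields the unit shift only when the cover orients both alike — useless in general.  THE REPAIR: the two VERTICAL faces
through the plain tie `X_C` (down by its explicit face) and the spectator tie `Z = X_C ∪ u`:
* the LOWER vertical face `gface X_C^{(b)} b u` (`b ∈ C`): if `Z` is UP its residue is `−R(C) − (ε_u − η_u)` (`unitShift_mem_of_lowerVertical`);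
* the UPPER vertical face `gface X_C v u` (`v ∈ F_0 ∖ C`): if `Z` is DOWN its residue is `η_u − ε_u` (`unitShift_mem_of_upperVertical`);
and `Z` IS down or up (§1: a spectator tie has potential `m + 1`, `bpot_eq_of_spectatorTie`, and an arc type at distance `m + 1` from it is `T_0` or `T_1`,
`rt_arcType_eq_zero_or_one_of_spectatorTie` — the three-type inequality of part XXI), by the face its cover holds (§2, `single_sub_normalForm_mem_of_face_of_mems`:
linearisation from an explicit face given the linearisations of the three lower corners, whatever their source).  Part XXVIII assembles the law for all `k ≥ 2`.

## References
* [Pohlmann1968] H. Pohlmann, Algebraic cycles on abelian varieties of complex multiplication type, Ann. of Math. 88 (1968), Thm 1.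
* [Milne1999] J. S. Milne, Lefschetz motives and the Tate conjecture, Compositio Math. 117 (1999), Prop. 2.1, p. 54.
-/

namespace Summit.HodgeConjecture.CorCM.Census.CyclicCharacter

open Finset
open Summit.HodgeConjecture.CorCM.Prior.AllgGroup.RfwfAllgGroup
open Summit.HodgeConjecture.CorCM.Census.BlockParity
open Summit.HodgeConjecture.CorCM.Census.Coinvariant
open Summit.HodgeConjecture.CorCM.Census.TwistGeneration
open Summit.HodgeConjecture.CorCM.Census.Nondegenerate
open Summit.HodgeConjecture.CorCM.Census.BaseBlock

noncomputable section

variable {G : Type*} [Group G] [Fintype G] [DecidableEq G] {k : ℕ} {w : G → ZMod (2 ^ k)} {c : G}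

/-! ## §1 Spectator ties: `T_0 ∖ Z = C ∪ {u}`, `2|C| = |F_0|`, `w u ≠ 0` -/

/-- **A spectator tie is at distance at least `|C| + 1` from every arc type** (`C` non-empty): the three-type inequality of part XXI, with one fibre when the
arc type meets the deviation and two fibres (two `w`-values) when it does not. [folklore] -/
theorem succ_card_le_ddist_of_spectatorTie (hw : ∀ P Q : G, w (P * Q) = w P + w Q) (hk : 1 ≤ k) (hc2 : c * c = 1) (hwc : w c ≠ 0) {Z : CMF G c}
    {C : Finset G} {u : G} (hZ : (arcType hw hk hc2 hwc 0).1 \ Z.1 = insert u C) (hCF : C ⊆ univ.filter fun s : G => w s = 0)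
    (hCm : 2 * C.card = (univ.filter fun s : G => w s = 0).card) (hCne : C.Nonempty) (hu0 : w u ≠ 0) (Q : G) :
    C.card + 1 ≤ ddist (rt c Q (arcType hw hk hc2 hwc 0)) Z := by
  have huC : u ∉ C := fun h => hu0 (mem_filter.mp (hCF h)).2
  have hcard : ((arcType hw hk hc2 hwc 0).1 \ Z.1).card = C.card + 1 := by rw [hZ, card_insert_of_notMem huC]
  by_cases hQ : rt c Q (arcType hw hk hc2 hwc 0) = arcType hw hk hc2 hwc 0
  · rw [hQ]; unfold ddist; rw [hcard]
  have hfar := card_ker_le_ddist_arcType_rt hw hk hc2 hwc hQ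
  have h3 := ddist_add_two_mul_card_le hc2 (arcType hw hk hc2 hwc 0) (rt c Q (arcType hw hk hc2 hwc 0)) Z
  rw [ddist_comm hc2 (rt c Q (arcType hw hk hc2 hwc 0)) (arcType hw hk hc2 hwc 0), hcard] at h3
  by_cases hmeet : (((arcType hw hk hc2 hwc 0).1 \ Z.1) ∩ (rt c Q (arcType hw hk hc2 hwc 0)).1).Nonempty
  · have h1 : 1 ≤ (((arcType hw hk hc2 hwc 0).1 \ Z.1) ∩ (rt c Q (arcType hw hk hc2 hwc 0)).1).card := card_pos.mpr hmeet
    omega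
  · -- `u` and a point of `C` lie in `T_0 ∖ T'`: two fibres
    rw [not_nonempty_iff_eq_empty] at hmeet
    obtain ⟨x, hx⟩ := hCne
    have hout : ∀ y ∈ (arcType hw hk hc2 hwc 0).1 \ Z.1, y ∈ (rt c 1 (arcType hw hk hc2 hwc 0)).1 \ (rt c Q (arcType hw hk hc2 hwc 0)).1 := by
      intro y hy
      rw [rt_one]
      refine mem_sdiff.mpr ⟨(mem_sdiff.mp hy).1, fun h => ?_⟩
      have : y ∈ (((arcType hw hk hc2 hwc 0).1 \ Z.1) ∩ (rt c Q (arcType hw hk hc2 hwc 0)).1) := mem_inter.mpr ⟨hy, h⟩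
      rw [hmeet] at this
      exact notMem_empty y this
    have huD : u ∈ (arcType hw hk hc2 hwc 0).1 \ Z.1 := by rw [hZ]; exact mem_insert_self u C
    have hxD : x ∈ (arcType hw hk hc2 hwc 0).1 \ Z.1 := by rw [hZ]; exact mem_insert_of_mem hx
    have h2 := two_mul_card_ker_le_ddist_of_mem hw hk hc2 hwc 1 Q (hout u huD) (hout x hxD) (by rw [(mem_filter.mp (hCF hx)).2]; exact hu0)
    rw [rt_one, ddist_comm hc2] at h2
    have h1 : 1 ≤ C.card := card_pos.mpr ⟨x, hx⟩
    omega

/-- **The potential of a spectator tie is `|C| + 1`.** [folklore] -/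
theorem bpot_eq_of_spectatorTie (hw : ∀ P Q : G, w (P * Q) = w P + w Q) (hk : 1 ≤ k) (hc2 : c * c = 1) (hwc : w c ≠ 0) {Z : CMF G c}
    {C : Finset G} {u : G} (hZ : (arcType hw hk hc2 hwc 0).1 \ Z.1 = insert u C) (hCF : C ⊆ univ.filter fun s : G => w s = 0)
    (hCm : 2 * C.card = (univ.filter fun s : G => w s = 0).card) (hCne : C.Nonempty) (hu0 : w u ≠ 0) :
    bpot c (arcType hw hk hc2 hwc 0) Z = C.card + 1 := by
  have huC : u ∉ C := fun h => hu0 (mem_filter.mp (hCF h)).2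
  apply le_antisymm
  · have h := bpot_le c (arcType hw hk hc2 hwc 0) Z 1
    rw [rt_one] at h
    unfold ddist at h
    rw [hZ, card_insert_of_notMem huC] at h
    exact h
  · obtain ⟨Q, hQ⟩ := exists_bpot_eq c (arcType hw hk hc2 hwc 0) Z
    rw [hQ]
    exact succ_card_le_ddist_of_spectatorTie hw hk hc2 hwc hZ hCF hCm hCne hu0 Q

/-- **THE TWO NEAREST ARC TYPES OF A SPECTATOR TIE.**  `T_0 ∖ Z = C ∪ {u}` with `C ⊆ F_0`, `2|C| = |F_0|`, `|C| ≥ 2`, `u ∈ T_0`, `w u ≠ 0`; if the arc type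
`T_0·Q⁻¹` is at distance exactly `|C| + 1` from `Z` then it is `T_0` or `T_1` (`k ≥ 2`, `w` onto).  By the three-type inequality `T_0·Q⁻¹` meets the deviation in
at most one point, hence (two fibres being too many) in exactly one, which must be `u`; then `F_0` fills `T_0 ∖ T_0·Q⁻¹` and `g₁` pins `w Q = −1` as in part XXIV.
[folklore] -/
theorem rt_arcType_eq_zero_or_one_of_spectatorTie (hw : ∀ P Q : G, w (P * Q) = w P + w Q) (hk : 1 ≤ k) (hk2 : 2 ≤ k) (hc2 : c * c = 1)
    (hwc : w c ≠ 0) (h1 : ∃ g₁ : G, w g₁ = 1) {Z : CMF G c} {C : Finset G} {u : G} (hZ : (arcType hw hk hc2 hwc 0).1 \ Z.1 = insert u C)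
    (hCF : C ⊆ univ.filter fun s : G => w s = 0) (hCm : 2 * C.card = (univ.filter fun s : G => w s = 0).card) (hC2 : 2 ≤ C.card)
    (hu0 : w u ≠ 0) {Q : G} (hQ : ddist (rt c Q (arcType hw hk hc2 hwc 0)) Z = C.card + 1) :
    rt c Q (arcType hw hk hc2 hwc 0) = arcType hw hk hc2 hwc 0 ∨ rt c Q (arcType hw hk hc2 hwc 0) = arcType hw hk hc2 hwc 1 := by
  haveI : NeZero (2 ^ k) := ⟨pow_ne_zero _ two_ne_zero⟩
  haveI : Fact (1 < 2 ^ k) := ⟨Nat.one_lt_two_pow (by omega)⟩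
  have huC : u ∉ C := fun h => hu0 (mem_filter.mp (hCF h)).2
  have hcard : ((arcType hw hk hc2 hwc 0).1 \ Z.1).card = C.card + 1 := by rw [hZ, card_insert_of_notMem huC]
  by_cases hQ0 : rt c Q (arcType hw hk hc2 hwc 0) = arcType hw hk hc2 hwc 0
  · exact Or.inl hQ0
  right
  have hfar := card_ker_le_ddist_arcType_rt hw hk hc2 hwc hQ0
  have h3 := ddist_add_two_mul_card_le hc2 (arcType hw hk hc2 hwc 0) (rt c Q (arcType hw hk hc2 hwc 0)) Z
  rw [ddist_comm hc2 (rt c Q (arcType hw hk hc2 hwc 0)) (arcType hw hk hc2 hwc 0), hcard, hQ] at h3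
  -- the arc type meets the deviation: otherwise two fibres
  have hout : ∀ y ∈ (arcType hw hk hc2 hwc 0).1 \ Z.1, y ∉ (rt c Q (arcType hw hk hc2 hwc 0)).1 →
      y ∈ (rt c 1 (arcType hw hk hc2 hwc 0)).1 \ (rt c Q (arcType hw hk hc2 hwc 0)).1 := by
    intro y hy h
    rw [rt_one]
    exact mem_sdiff.mpr ⟨(mem_sdiff.mp hy).1, h⟩
  have huD : u ∈ (arcType hw hk hc2 hwc 0).1 \ Z.1 := by rw [hZ]; exact mem_insert_self u C
  obtain ⟨x, hx, x', hx', hxx'⟩ := one_lt_card.mp (by omega : 1 < C.card)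
  have hx0 : w x = 0 := (mem_filter.mp (hCF hx)).2
  have hx'0 : w x' = 0 := (mem_filter.mp (hCF hx')).2
  have hxD : x ∈ (arcType hw hk hc2 hwc 0).1 \ Z.1 := by rw [hZ]; exact mem_insert_of_mem hx
  have hx'D : x' ∈ (arcType hw hk hc2 hwc 0).1 \ Z.1 := by rw [hZ]; exact mem_insert_of_mem hx'
  -- `u ∈ T'`: otherwise the fibre of `u` fills `T_0 ∖ T'` and both `x`, `x'` lie in `T'`, two points of the intersection
  have huT' : u ∈ (rt c Q (arcType hw hk hc2 hwc 0)).1 := by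
    by_contra huT'
    have hxT' : ∀ y ∈ C, y ∈ (rt c Q (arcType hw hk hc2 hwc 0)).1 := by
      intro y hy
      by_contra hyT'
      have hyD : y ∈ (arcType hw hk hc2 hwc 0).1 \ Z.1 := by rw [hZ]; exact mem_insert_of_mem hy
      have h2 := two_mul_card_ker_le_ddist_of_mem hw hk hc2 hwc 1 Q (hout u huD huT') (hout y hyD hyT')
        (by rw [(mem_filter.mp (hCF hy)).2]; exact hu0)
      rw [rt_one, ddist_comm hc2] at h2
      omega
    have htwo : 2 ≤ (((arcType hw hk hc2 hwc 0).1 \ Z.1) ∩ (rt c Q (arcType hw hk hc2 hwc 0)).1).card := by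
      have hsub : ({x, x'} : Finset G) ⊆ ((arcType hw hk hc2 hwc 0).1 \ Z.1) ∩ (rt c Q (arcType hw hk hc2 hwc 0)).1 := by
        intro y hy
        rw [mem_insert, mem_singleton] at hy
        rcases hy with rfl | rfl
        · exact mem_inter.mpr ⟨hxD, hxT' _ hx⟩
        · exact mem_inter.mpr ⟨hx'D, hxT' _ hx'⟩
      have := card_le_card hsub
      rw [card_pair hxx'] at this
      exact this
    omega
  -- so `x ∉ T'` (else `u`, `x` are two points of the intersection), and the fibre `F_0` fills `T_0 ∖ T'`
  have hxT' : x ∉ (rt c Q (arcType hw hk hc2 hwc 0)).1 := by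
    intro h
    have hsub : ({u, x} : Finset G) ⊆ ((arcType hw hk hc2 hwc 0).1 \ Z.1) ∩ (rt c Q (arcType hw hk hc2 hwc 0)).1 := by
      intro y hy
      rw [mem_insert, mem_singleton] at hy
      rcases hy with rfl | rfl
      · exact mem_inter.mpr ⟨huD, huT'⟩
      · exact mem_inter.mpr ⟨hxD, h⟩
    have := card_le_card hsub
    rw [card_pair (fun h : u = x => hu0 (by rw [h]; exact hx0))] at this
    omega
  have hxT0' : x ∈ (arcType hw hk hc2 hwc 0).1 \ (rt c Q (arcType hw hk hc2 hwc 0)).1 := mem_sdiff.mpr ⟨(mem_sdiff.mp hxD).1, hxT'⟩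
  have hone : 1 ≤ (((arcType hw hk hc2 hwc 0).1 \ Z.1) ∩ (rt c Q (arcType hw hk hc2 hwc 0)).1).card :=
    card_pos.mpr ⟨u, mem_inter.mpr ⟨huD, huT'⟩⟩
  have hcardT' : ((arcType hw hk hc2 hwc 0).1 \ (rt c Q (arcType hw hk hc2 hwc 0)).1).card = (univ.filter fun s : G => w s = 0).card := by
    unfold ddist at hfar h3
    omega
  have himg : ((univ.filter fun n : G => w n = 0).image fun n => x * n) ⊆ (arcType hw hk hc2 hwc 0).1 \ (rt c Q (arcType hw hk hc2 hwc 0)).1 := by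
    intro y hy
    obtain ⟨n, hn, rfl⟩ := mem_image.mp hy
    exact mul_mem_sdiff_rt_arcType hw hk hc2 hwc Q hxT0' (mem_filter.mp hn).2
  have himg_eq : ((univ.filter fun n : G => w n = 0).image fun n => x * n) = (arcType hw hk hc2 hwc 0).1 \ (rt c Q (arcType hw hk hc2 hwc 0)).1 :=
    eq_of_subset_of_card_le himg (by rw [card_image_of_injective _ (mul_right_injective x), hcardT'])
  -- the point `g₁` lies in `T_0` but not in `T_0 ∖ T'`
  obtain ⟨g₁, hg₁⟩ := h1
  have hg₁T : g₁ ∈ (arcType hw hk hc2 hwc 0).1 :=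
    (mem_arcType_of_apply_eq_natCast hw hk hc2 hwc (j := 1) (by rw [hg₁, Nat.cast_one]) (Nat.one_lt_two_pow (by omega))).1
  have hg₁T' : g₁ ∈ (rt c Q (arcType hw hk hc2 hwc 0)).1 := by
    by_contra h
    have hmem : g₁ ∈ (arcType hw hk hc2 hwc 0).1 \ (rt c Q (arcType hw hk hc2 hwc 0)).1 := mem_sdiff.mpr ⟨hg₁T, h⟩
    rw [← himg_eq] at hmem
    obtain ⟨n, hn, hn'⟩ := mem_image.mp hmem
    have e := congrArg w hn'
    rw [hw, hx0, (mem_filter.mp hn).2, add_zero, hg₁] at e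
    exact one_ne_zero e.symm
  -- read off `w Q = -1`
  have hv1 : ¬ (w Q).val < 2 ^ (k - 1) := by
    have h := hxT'
    rwa [rt_arcType, mem_arcType, hx0, zero_sub, zero_sub, neg_neg] at h
  have hv2 : (1 + w Q).val < 2 ^ (k - 1) := by
    have h := hg₁T'
    rwa [rt_arcType, mem_arcType, hg₁, zero_sub, sub_neg_eq_add] at h
  have hwQ : w Q = -1 := by
    by_contra hne'
    have hu : 1 + w Q ≠ 0 := fun h => hne' (eq_neg_of_add_eq_zero_right h)
    have h1le : (1 : ZMod (2 ^ k)).val ≤ (1 + w Q).val := by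
      rw [ZMod.val_one]
      exact Nat.one_le_iff_ne_zero.mpr fun h => hu ((ZMod.val_eq_zero _).mp h)
    have hvs := ZMod.val_sub h1le
    rw [add_sub_cancel_left, ZMod.val_one] at hvs
    omega
  rw [rt_arcType, hwQ, zero_sub, neg_neg]

/-! ## §2 Linearisation from an explicit face, given the three lower corners -/

/-- **LINEARISATION FROM AN EXPLICIT FACE, flexible form.**  If `L` contains the face `gface Φ b b'` at two distinct deviation places `b ≠ b' ∈ T ∖ Φ`
(`T = T_0·Q₀⁻¹`) and the three lower corners `Φ^{(b)(b')}`, `Φ^{(b)}`, `Φ^{(b')}` are linearised toward `T` in `L` (from whatever source: half a fibre, uniqueness,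
an explicit face), then so is `Φ`. [folklore] -/
theorem single_sub_normalForm_mem_of_face_of_mems (hc2 : c * c = 1) (L : Submodule ℤ (CMF G c →₀ ℤ)) (T : CMF G c) {Φ : CMF G c}
    {b b' : G} (hb : b ∈ T.1 \ Φ.1) (hb' : b' ∈ T.1 \ Φ.1) (hbb' : b ≠ b') (hf : gface c hc2 Φ b b' ∈ L)
    (e₂ : Finsupp.single (oflipCM c hc2 b (oflipCM c hc2 b' Φ)) (1 : ℤ) - ((∑ t ∈ T.1 \ (oflipCM c hc2 b (oflipCM c hc2 b' Φ)).1,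
      (Finsupp.single (oflipCM c hc2 t T) (1 : ℤ) - Finsupp.single T 1)) + Finsupp.single T 1) ∈ L)
    (e₃ : Finsupp.single (oflipCM c hc2 b Φ) (1 : ℤ) - ((∑ t ∈ T.1 \ (oflipCM c hc2 b Φ).1,
      (Finsupp.single (oflipCM c hc2 t T) (1 : ℤ) - Finsupp.single T 1)) + Finsupp.single T 1) ∈ L)
    (e₄ : Finsupp.single (oflipCM c hc2 b' Φ) (1 : ℤ) - ((∑ t ∈ T.1 \ (oflipCM c hc2 b' Φ).1,
      (Finsupp.single (oflipCM c hc2 t T) (1 : ℤ) - Finsupp.single T 1)) + Finsupp.single T 1) ∈ L) :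
    Finsupp.single Φ (1 : ℤ) - ((∑ t ∈ T.1 \ Φ.1, (Finsupp.single (oflipCM c hc2 t T) (1 : ℤ) - Finsupp.single T 1)) + Finsupp.single T 1) ∈ L := by
  set E : G → (CMF G c →₀ ℤ) := fun t => Finsupp.single (oflipCM c hc2 t T) (1 : ℤ) - Finsupp.single T 1 with hE
  have hdb : T.1 \ (oflipCM c hc2 b Φ).1 = (T.1 \ Φ.1).erase b := dev_oflip c hc2 (mem_sdiff.mp hb).1 (mem_sdiff.mp hb).2
  have hdb' : T.1 \ (oflipCM c hc2 b' Φ).1 = (T.1 \ Φ.1).erase b' := dev_oflip c hc2 (mem_sdiff.mp hb').1 (mem_sdiff.mp hb').2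
  have hbm : b ∈ T.1 \ (oflipCM c hc2 b' Φ).1 := by rw [hdb']; exact mem_erase.mpr ⟨hbb', hb⟩
  have hdbb' : T.1 \ (oflipCM c hc2 b (oflipCM c hc2 b' Φ)).1 = ((T.1 \ Φ.1).erase b').erase b := by
    rw [dev_oflip c hc2 (mem_sdiff.mp hbm).1 (mem_sdiff.mp hbm).2, hdb']
  rw [hdbb'] at e₂
  rw [hdb] at e₃
  rw [hdb'] at e₄
  have h := Submodule.add_mem _ (Submodule.add_mem _ (Submodule.sub_mem _ hf e₂) e₃) e₄
  have s1 : (∑ t ∈ T.1 \ Φ.1, E t) = E b + ∑ t ∈ (T.1 \ Φ.1).erase b, E t := (add_sum_erase _ _ hb).symm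
  have s2 : (∑ t ∈ (T.1 \ Φ.1).erase b', E t) = E b + ∑ t ∈ ((T.1 \ Φ.1).erase b').erase b, E t :=
    (add_sum_erase _ _ (mem_erase.mpr ⟨hbb', hb⟩)).symm
  rw [s1]
  rw [s2] at h
  convert h using 1
  simp only [gface, hE]
  abel

/-! ## §3 The two vertical faces through `X_C` and the spectator tie `Z = X_C ∪ u` -/

/-- **THE LOWER VERTICAL FACE, spectator tie UP.**  `L` with the toward property; `T_0 ∖ X' = C ∖ b` (`b ∈ C ⊆ F_0`, `2|C| = |F_0|`, `|C| ≥ 2`); a spectator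
`u ∈ T_0 ∩ T_1` (`w u ≠ 0`); the face `gface X' b u` in `L`; the plain tie `X'^{(b)} = X_C` linearised DOWN (`eC`) and the spectator tie `Z = X'^{(b)(u)}`
linearised UP (`eZ`) in `L`; and `R(C) ∈ L`.  Then the unit arc shift `(ε_u) − (η_u)` lies in `L` (the residue of the face is `−R(C) − (ε_u − η_u)`). [folklore] -/
theorem unitShift_mem_of_lowerVertical (hw : ∀ P Q : G, w (P * Q) = w P + w Q) (hk : 1 ≤ k) (hc2 : c * c = 1) (hwc : w c ≠ 0)
    (h1 : ∃ g₁ : G, w g₁ = 1) (L : Submodule ℤ (CMF G c →₀ ℤ))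
    (htw : ∀ Φ : CMF G c, 2 ≤ bpot c (arcType hw hk hc2 hwc 0) Φ → ∃ Q t t' : G,
      bpot c (arcType hw hk hc2 hwc 0) Φ = ddist (rt c Q (arcType hw hk hc2 hwc 0)) Φ ∧
        t ∈ (rt c Q (arcType hw hk hc2 hwc 0)).1 \ Φ.1 ∧ t' ∈ (rt c Q (arcType hw hk hc2 hwc 0)).1 \ Φ.1 ∧ t ≠ t' ∧ gface c hc2 Φ t t' ∈ L)
    {X' : CMF G c} {C : Finset G} {b u : G} (hb : b ∈ C) (hX' : (arcType hw hk hc2 hwc 0).1 \ X'.1 = C.erase b)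
    (hCF : C ⊆ univ.filter fun s : G => w s = 0) (hCm : 2 * C.card = (univ.filter fun s : G => w s = 0).card) (hC2 : 2 ≤ C.card)
    (hu0 : w u ≠ 0) (huT0 : u ∈ (arcType hw hk hc2 hwc 0).1) (huT1 : u ∈ (arcType hw hk hc2 hwc 1).1) (hf : gface c hc2 X' b u ∈ L)
    (eC : Finsupp.single (oflipCM c hc2 b X') (1 : ℤ) - ((∑ s ∈ (arcType hw hk hc2 hwc 0).1 \ (oflipCM c hc2 b X').1,
      (Finsupp.single (oflipCM c hc2 s (arcType hw hk hc2 hwc 0)) (1 : ℤ) - Finsupp.single (arcType hw hk hc2 hwc 0) 1)) +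
        Finsupp.single (arcType hw hk hc2 hwc 0) 1) ∈ L)
    (eZ : Finsupp.single (oflipCM c hc2 b (oflipCM c hc2 u X')) (1 : ℤ) - ((∑ s ∈ (arcType hw hk hc2 hwc 1).1 \ (oflipCM c hc2 b (oflipCM c hc2 u X')).1,
      (Finsupp.single (oflipCM c hc2 s (arcType hw hk hc2 hwc 1)) (1 : ℤ) - Finsupp.single (arcType hw hk hc2 hwc 1) 1)) +
        Finsupp.single (arcType hw hk hc2 hwc 1) 1) ∈ L)
    (hR : Finsupp.single (arcType hw hk hc2 hwc 0) (1 : ℤ) - Finsupp.single (arcType hw hk hc2 hwc 1) 1 +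
      (∑ s ∈ C, (Finsupp.single (oflipCM c hc2 s (arcType hw hk hc2 hwc 0)) (1 : ℤ) - Finsupp.single (arcType hw hk hc2 hwc 0) 1)) -
      (∑ s ∈ (univ.filter fun s => w s = 0) \ C,
        (Finsupp.single (oflipCM c hc2 s (arcType hw hk hc2 hwc 1)) (1 : ℤ) - Finsupp.single (arcType hw hk hc2 hwc 1) 1)) ∈ L) :
    (Finsupp.single (oflipCM c hc2 u (arcType hw hk hc2 hwc 0)) (1 : ℤ) - Finsupp.single (arcType hw hk hc2 hwc 0) 1) -
      (Finsupp.single (oflipCM c hc2 u (arcType hw hk hc2 hwc 1)) (1 : ℤ) - Finsupp.single (arcType hw hk hc2 hwc 1) 1) ∈ L := by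
  obtain ⟨Qm, hQm⟩ := exists_apply_eq hw h1 (-1)
  have eT₁ : arcType hw hk hc2 hwc 1 = rt c Qm (arcType hw hk hc2 hwc 0) := arcType_eq_rt hw hk hc2 hwc hQm
  have hb0 : w b = 0 := (mem_filter.mp (hCF hb)).2
  have huC : u ∉ C := fun h => hu0 (mem_filter.mp (hCF h)).2
  have hbu : b ≠ u := fun h => hu0 (h ▸ hb0)
  have hn2 : 2 ≤ (univ.filter fun s : G => w s = 0).card := by omega
  -- deviation sets of the four corners
  have hXb : (arcType hw hk hc2 hwc 0).1 \ (oflipCM c hc2 b X').1 = C := by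
    rw [sdiff_oflipCM_eq_insert hw hk hc2 hwc hX' hb0 (notMem_erase b C), insert_erase hb]
  have huTX : u ∈ (arcType hw hk hc2 hwc 0).1 ∧ u ∈ X'.1 := by
    refine ⟨huT0, ?_⟩
    by_contra h
    have : u ∈ (arcType hw hk hc2 hwc 0).1 \ X'.1 := mem_sdiff.mpr ⟨huT0, h⟩
    rw [hX'] at this
    exact huC (mem_of_mem_erase this)
  have hXu : (arcType hw hk hc2 hwc 0).1 \ (oflipCM c hc2 u X').1 = insert u (C.erase b) := by
    rw [dev_oflip_of_mem c hc2 huTX.1 huTX.2, hX']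
  have hXbu : (arcType hw hk hc2 hwc 0).1 \ (oflipCM c hc2 b (oflipCM c hc2 u X')).1 = insert u C := by
    rw [sdiff_oflipCM_eq_insert hw hk hc2 hwc hXu hb0 (by rw [mem_insert]; push Not; exact ⟨hbu, notMem_erase b C⟩),
      Finset.insert_comm, insert_erase hb]
  have hCe : C.erase b ⊆ univ.filter fun s : G => w s = 0 := (erase_subset b C).trans hCF
  have hce : (C.erase b).card + 1 = C.card := card_erase_add_one hb
  -- linearisations of the four corners
  have h₁ : 2 * ddist (rt c 1 (arcType hw hk hc2 hwc 0)) X' < (univ.filter fun s : G => w s = 0).card := by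
    rw [rt_one]; unfold ddist; rw [hX']; omega
  have e₁ := single_sub_normalForm_mem_of_toward hw hk hc2 hwc L htw 1 X' h₁
  have e₂ : Finsupp.single (oflipCM c hc2 b (oflipCM c hc2 u X')) (1 : ℤ) - ((∑ s ∈ (rt c Qm (arcType hw hk hc2 hwc 0)).1 \ (oflipCM c hc2 b (oflipCM c hc2 u X')).1,
      (Finsupp.single (oflipCM c hc2 s (rt c Qm (arcType hw hk hc2 hwc 0))) (1 : ℤ) - Finsupp.single (rt c Qm (arcType hw hk hc2 hwc 0)) 1)) +
        Finsupp.single (rt c Qm (arcType hw hk hc2 hwc 0)) 1) ∈ L := by rw [← eT₁]; exact eZ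
  have e₃ : Finsupp.single (oflipCM c hc2 b X') (1 : ℤ) - ((∑ s ∈ (rt c 1 (arcType hw hk hc2 hwc 0)).1 \ (oflipCM c hc2 b X').1,
      (Finsupp.single (oflipCM c hc2 s (rt c 1 (arcType hw hk hc2 hwc 0))) (1 : ℤ) - Finsupp.single (rt c 1 (arcType hw hk hc2 hwc 0)) 1)) +
        Finsupp.single (rt c 1 (arcType hw hk hc2 hwc 0)) 1) ∈ L := by rw [rt_one]; exact eC
  obtain ⟨x, hx⟩ : (C.erase b).Nonempty := by rw [← card_pos]; omega
  have hx0 : w x = 0 := (mem_filter.mp (hCe hx)).2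
  have hU4 := unique_base_zero hw hk hc2 hwc (Φ := oflipCM c hc2 u X')
    (by rw [hXu, card_insert_of_notMem (fun h => huC (mem_of_mem_erase h))]; omega)
    (fun _ => ⟨u, by rw [hXu]; exact mem_insert_self _ _, x, by rw [hXu]; exact mem_insert_of_mem hx, fun h => hu0 (h.trans hx0)⟩) hn2
  have e₄ := single_sub_normalForm_mem_of_toward_of_unique hw hk hc2 hwc L htw 1 _ hU4
  have hrel := alt_normalForm_mem_of_mems hw hk hc2 hwc L hf 1 Qm 1 1 e₁ e₂ e₃ e₄
  rw [rt_one, ← eT₁, hX', hXb, hXu, normalForm_one_eq_of_spectator hw hk hc2 hwc _ hXbu hCF huT1 hu0,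
    sum_insert (fun h => huC (mem_of_mem_erase h))] at hrel
  set E : G → (CMF G c →₀ ℤ) := fun s =>
    Finsupp.single (oflipCM c hc2 s (arcType hw hk hc2 hwc 0)) (1 : ℤ) - Finsupp.single (arcType hw hk hc2 hwc 0) 1 with hE
  have e1 : (∑ s ∈ C, E s) = E b + ∑ s ∈ C.erase b, E s := (add_sum_erase C E hb).symm
  rw [e1] at hrel hR
  have h := Submodule.add_mem _ hrel hR
  rw [← Submodule.neg_mem_iff]
  convert h using 1
  simp only [hE]
  abel

/-- **THE UPPER VERTICAL FACE, spectator tie DOWN.**  `L` with the toward property; `T_0 ∖ X = C ⊆ F_0` (`2|C| = |F_0|`, `|C| ≥ 2`); `v ∈ F_0 ∖ C`; a spectator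
`u ∈ T_0 ∩ T_1` (`w u ≠ 0`); the face `gface X v u` in `L`; `X = X_C` linearised DOWN (`eC`) and the spectator tie `Z = X^{(u)}` linearised DOWN (`eZ`) in
`L`.  Then the unit arc shift `(ε_u) − (η_u)` lies in `L` (the residue of the face is `η_u − ε_u`). [folklore] -/
theorem unitShift_mem_of_upperVertical (hw : ∀ P Q : G, w (P * Q) = w P + w Q) (hk : 1 ≤ k) (hc2 : c * c = 1) (hwc : w c ≠ 0)
    (h1 : ∃ g₁ : G, w g₁ = 1) (L : Submodule ℤ (CMF G c →₀ ℤ))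
    (htw : ∀ Φ : CMF G c, 2 ≤ bpot c (arcType hw hk hc2 hwc 0) Φ → ∃ Q t t' : G,
      bpot c (arcType hw hk hc2 hwc 0) Φ = ddist (rt c Q (arcType hw hk hc2 hwc 0)) Φ ∧
        t ∈ (rt c Q (arcType hw hk hc2 hwc 0)).1 \ Φ.1 ∧ t' ∈ (rt c Q (arcType hw hk hc2 hwc 0)).1 \ Φ.1 ∧ t ≠ t' ∧ gface c hc2 Φ t t' ∈ L)
    {X : CMF G c} {C : Finset G} {v u : G} (hX : (arcType hw hk hc2 hwc 0).1 \ X.1 = C)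
    (hCF : C ⊆ univ.filter fun s : G => w s = 0) (hCm : 2 * C.card = (univ.filter fun s : G => w s = 0).card) (hC2 : 2 ≤ C.card)
    (hv : v ∈ (univ.filter fun s : G => w s = 0) \ C)
    (hu0 : w u ≠ 0) (huT0 : u ∈ (arcType hw hk hc2 hwc 0).1) (huT1 : u ∈ (arcType hw hk hc2 hwc 1).1) (hf : gface c hc2 X v u ∈ L)
    (eC : Finsupp.single X (1 : ℤ) - ((∑ s ∈ (arcType hw hk hc2 hwc 0).1 \ X.1,
      (Finsupp.single (oflipCM c hc2 s (arcType hw hk hc2 hwc 0)) (1 : ℤ) - Finsupp.single (arcType hw hk hc2 hwc 0) 1)) +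
        Finsupp.single (arcType hw hk hc2 hwc 0) 1) ∈ L)
    (eZ : Finsupp.single (oflipCM c hc2 u X) (1 : ℤ) - ((∑ s ∈ (arcType hw hk hc2 hwc 0).1 \ (oflipCM c hc2 u X).1,
      (Finsupp.single (oflipCM c hc2 s (arcType hw hk hc2 hwc 0)) (1 : ℤ) - Finsupp.single (arcType hw hk hc2 hwc 0) 1)) +
        Finsupp.single (arcType hw hk hc2 hwc 0) 1) ∈ L) :
    (Finsupp.single (oflipCM c hc2 u (arcType hw hk hc2 hwc 0)) (1 : ℤ) - Finsupp.single (arcType hw hk hc2 hwc 0) 1) -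
      (Finsupp.single (oflipCM c hc2 u (arcType hw hk hc2 hwc 1)) (1 : ℤ) - Finsupp.single (arcType hw hk hc2 hwc 1) 1) ∈ L := by
  obtain ⟨Qm, hQm⟩ := exists_apply_eq hw h1 (-1)
  have eT₁ : arcType hw hk hc2 hwc 1 = rt c Qm (arcType hw hk hc2 hwc 0) := arcType_eq_rt hw hk hc2 hwc hQm
  have hv0 : w v = 0 := (mem_filter.mp (mem_sdiff.mp hv).1).2
  have hvC : v ∉ C := (mem_sdiff.mp hv).2
  have huC : u ∉ C := fun h => hu0 (mem_filter.mp (hCF h)).2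
  have hvu : v ≠ u := fun h => hu0 (h ▸ hv0)
  have hn2 : 2 ≤ (univ.filter fun s : G => w s = 0).card := by omega
  have hwcs : ∀ s : G, w s = 0 → w (c * s) ≠ w u := by
    intro s hs h
    rw [hw, hs, add_zero, apply_c hw hk hc2 hwc] at h
    have := (mem_arcType hw hk hc2 hwc 0 u).mp huT0
    rw [sub_zero, ← h, val_two_pow_pred hk] at this
    exact lt_irrefl _ this
  -- deviation sets of the four corners
  have huTX : u ∈ (arcType hw hk hc2 hwc 0).1 ∧ u ∈ X.1 := by
    refine ⟨huT0, ?_⟩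
    by_contra h
    have : u ∈ (arcType hw hk hc2 hwc 0).1 \ X.1 := mem_sdiff.mpr ⟨huT0, h⟩
    rw [hX] at this
    exact huC this
  have hXu : (arcType hw hk hc2 hwc 0).1 \ (oflipCM c hc2 u X).1 = insert u C := by rw [dev_oflip_of_mem c hc2 huTX.1 huTX.2, hX]
  have hXv : (arcType hw hk hc2 hwc 0).1 \ (oflipCM c hc2 v X).1 = insert v C := sdiff_oflipCM_eq_insert hw hk hc2 hwc hX hv0 hvC
  have hXvu : (arcType hw hk hc2 hwc 0).1 \ (oflipCM c hc2 v (oflipCM c hc2 u X)).1 = insert u (insert v C) := by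
    rw [sdiff_oflipCM_eq_insert hw hk hc2 hwc hXu hv0 (by rw [mem_insert]; push Not; exact ⟨hvu, hvC⟩), Finset.insert_comm]
  have hCv : insert v C ⊆ univ.filter fun s : G => w s = 0 := insert_subset (mem_sdiff.mp hv).1 hCF
  have hcv : (insert v C).card = C.card + 1 := card_insert_of_notMem hvC
  -- linearisations of the four corners
  have e₁ : Finsupp.single X (1 : ℤ) - ((∑ s ∈ (rt c 1 (arcType hw hk hc2 hwc 0)).1 \ X.1,
      (Finsupp.single (oflipCM c hc2 s (rt c 1 (arcType hw hk hc2 hwc 0))) (1 : ℤ) - Finsupp.single (rt c 1 (arcType hw hk hc2 hwc 0)) 1)) +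
        Finsupp.single (rt c 1 (arcType hw hk hc2 hwc 0)) 1) ∈ L := by rw [rt_one]; exact eC
  -- the corner `X^{(v)(u)}` is `T_1`-unique: `T_1`-deviation `c·(F_0 ∖ (C ∪ v)) ∪ {u}` of size `m` with two `w`-values
  have hdev2 := sdiff_arcType_one_eq_of_spectator hw hk hc2 hwc (oflipCM c hc2 v (oflipCM c hc2 u X)) hXvu hCv huT1 hu0
  have hcard2 : ((rt c Qm (arcType hw hk hc2 hwc 0)).1 \ (oflipCM c hc2 v (oflipCM c hc2 u X)).1).card + (insert v C).card =
      (univ.filter fun s : G => w s = 0).card + 1 := by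
    rw [← eT₁]; exact ddist_arcType_one_of_spectator hw hk hc2 hwc _ hXvu hCv huT1 hu0
  have hU2 : ∀ Ψ : CMF G c, (rt c Qm (arcType hw hk hc2 hwc 0)).1 \ Ψ.1 ⊆ (rt c Qm (arcType hw hk hc2 hwc 0)).1 \ (oflipCM c hc2 v (oflipCM c hc2 u X)).1 →
      ∀ Q : G, bpot c (arcType hw hk hc2 hwc 0) Ψ = ddist (rt c Q (arcType hw hk hc2 hwc 0)) Ψ → rt c Q (arcType hw hk hc2 hwc 0) = rt c Qm (arcType hw hk hc2 hwc 0) := by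
    refine unique_of_sdiff_small hw hk hc2 hwc (by rw [hcv] at hcard2; omega) (fun hle => ?_) hn2
    have hne : (((univ.filter fun s : G => w s = 0)) \ insert v C).Nonempty := by
      rw [nonempty_iff_ne_empty]; intro h
      have := card_sdiff_add_card_eq_card hCv; rw [h, card_empty, zero_add, hcv] at this; omega
    obtain ⟨s, hs⟩ := hne
    refine ⟨u, ?_, c * s, ?_, fun h => hwcs s (mem_filter.mp (mem_sdiff.mp hs).1).2 h.symm⟩
    · rw [← eT₁, hdev2]; exact mem_insert_self _ _
    · rw [← eT₁, hdev2]; exact mem_insert_of_mem (mem_image_of_mem _ hs)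
  have e₂ := single_sub_normalForm_mem_of_toward_of_unique hw hk hc2 hwc L htw Qm _ hU2
  have h₃ : 2 * ddist (rt c Qm (arcType hw hk hc2 hwc 0)) (oflipCM c hc2 v X) < (univ.filter fun s : G => w s = 0).card := by
    rw [← eT₁, ddist_arcType_one_eq hw hk hc2 hwc hXv hCv, hcv]; omega
  have e₃ := single_sub_normalForm_mem_of_toward hw hk hc2 hwc L htw Qm _ h₃
  have e₄ : Finsupp.single (oflipCM c hc2 u X) (1 : ℤ) - ((∑ s ∈ (rt c 1 (arcType hw hk hc2 hwc 0)).1 \ (oflipCM c hc2 u X).1,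
      (Finsupp.single (oflipCM c hc2 s (rt c 1 (arcType hw hk hc2 hwc 0))) (1 : ℤ) - Finsupp.single (rt c 1 (arcType hw hk hc2 hwc 0)) 1)) +
        Finsupp.single (rt c 1 (arcType hw hk hc2 hwc 0)) 1) ∈ L := by rw [rt_one]; exact eZ
  have hrel := alt_normalForm_mem_of_mems hw hk hc2 hwc L hf 1 Qm Qm 1 e₁ e₂ e₃ e₄
  rw [rt_one, ← eT₁, hX, hXu, normalForm_one_eq_of_spectator hw hk hc2 hwc _ hXvu hCv huT1 hu0,
    normalForm_one_eq hw hk hc2 hwc _ (hXv.symm ▸ hCv), hXv, sum_insert huC] at hrel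
  rw [← Submodule.neg_mem_iff]
  convert hrel using 1
  abel

end

end Summit.HodgeConjecture.CorCM.Census.CyclicCharacter
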